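import Mathlib
import HarnessLib
import Summits.Ventures.LatticeQCDFlow.Exactness.OpenBoundaryTimeReflection
import Summits.Ventures.LatticeQCDFlow.Scoring.CloverDensityMeanZero

/-!
# Lattice translations preserve the periodic Wilson measure and, when orthogonal to the time axis, the open-boundary Gibbs law; the clover charge density has zero mean at every site

HONEST FRAMING: exact (Metropolis-corrected) sampling algorithms for lattice gauge theory;
figures of merit are autocorrelation/cost numbers at stated couplings and volumes; no
continuum-physics claim.

Venture `LatticeQCDFlow` (cell pub-lqcd), topic `Exactness`, FANOUT row 21 (`su3-base`: arms `1HB+4OR` and `PBC-HMC` on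
the periodic lattice, `OBC-HMC` with open boundary conditions in the time direction `τ`, `OpenBoundaryWilsonAction.lean`).
NEW WORK of the cell over the tree (`PTBCWilsonDefect.lean`: `configTranslate v`, `measurePreserving_configTranslate`,
`weightedWilsonAction_configTranslate` for constant weights; `OpenBoundaryTimeReflection.lean`:
`weightedWilsonAction_configTranslate_eq`, `weightedWilsonAction_negReflect`, `cloverPseudoscalar_configTranslate`;
the Literature `wilsonMeasure` / `wilsonExpectation` of `ConstructiveQFTWave0` and its site time reflection `Θ'`;
row 16's `Scoring/CloverChargeMeanZero` / `CloverDensityMeanZero`: `wilsonExpectation_eq_zero_of_negReflect_odd`,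
`wilsonExpectation_cloverPseudoscalar_eq_zero_of_fixed` and the periodic every-site statement
`Scoring.wilsonExpectation_cloverPseudoscalar_eq_zero` (via `torusConfigShift`), IMPORTED and reused here — the periodic
translation invariance below is the `configTranslate` form of the same symmetry; the NEW content is the open-boundary part).
Nothing is cited as a fact; no definition; no number.

## What is proved

* §1 PERIODIC (`(ℤ/L)^d`, any group, any `ρ`, every real `β`, every lattice vector `v`): `wilsonAction_configTranslate`;
  **`wilsonMeasure_map_configTranslate`** (`μ_{Λ,β} ∘ T_v⁻¹ = μ_{Λ,β}`), `measurePreserving_configTranslate_wilsonMeasure`,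
  `wilsonExpectation_comp_configTranslate` (`⟨F ∘ T_v⟩ = ⟨F⟩`); `negReflect_eq_self_of_apply_zero`;
  `wilsonExpectation_sum_cloverPseudoscalar_eq_zero` (`⟨Σ_{x ∈ S} P_x⟩ = 0` for EVERY finite set of sites, from row 16's
  every-site `Scoring.wilsonExpectation_cloverPseudoscalar_eq_zero`); the `SU(N)` instance.
* §2 OPEN BOUNDARY, TRANSLATIONS ORTHOGONAL TO `τ` (`v_τ = 0`; every `d`, `L ≥ 1`, any `τ`): `obcWeight_translate`,
  **`obcAction_configTranslate`** (`S_OBC(T_v U) = S_OBC(U)`), **`obcGibbs_map_configTranslate`**,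
  `measurePreserving_configTranslate_obcGibbs`, `obcGibbs_integral_comp_configTranslate` (`⟨F ∘ T_v⟩_OBC = ⟨F⟩_OBC`).
* §3 OPEN BOUNDARY IN A DIRECTION `τ ≠ 0`, THE SITE REFLECTION `Θ'` OF DIRECTION `0` (a SPATIAL reflection for that
  open lattice): `obcWeight_sitePlaqReflect` (the weights only read the `τ`-coordinate, which `ϑ'` does not move),
  **`obcAction_negReflect`** (`S_OBC(Θ'U) = S_OBC(U)`), **`obcGibbs_map_negReflect`**,
  `measurePreserving_negReflect_obcGibbs`, `obcGibbs_integral_eq_zero_of_negReflect_odd`.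
* §4 THE CLOVER DENSITY WITH OPEN BOUNDARIES (`d = 4`, `τ ≠ 0`, compact `G`, continuous unitary `ρ`, every `β`,
  `L ≥ 1`): `isProbabilityMeasure_obcGibbs`, `integrable_cloverPseudoscalar_obcGibbs`;
  **`obcGibbs_cloverPseudoscalar_integral_eq_zero`** — `⟨P_x⟩_OBC = 0` AT EVERY SITE (boundary slices included);
  **`obcGibbs_sum_cloverPseudoscalar_integral_eq_zero`** — `⟨Σ_{x ∈ S} P_x⟩_OBC = 0` for EVERY finite set `S` (no
  symmetry condition on `S`: linearity); the `SU(N)` instance `obcGibbs_su_sum_cloverPseudoscalar_integral_eq_zero`.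

With `OpenBoundaryTimeReflection.lean` (time direction `0`, the boundary-exchanging reflection, symmetric LAW of `Q_S` on
mirror-symmetric `S`) this covers both placements of the open direction the engine may use.

NOT CLAIMED: the symmetric law / vanishing odd moments of `Q_S` for a NON-symmetric `S` (false in general beyond the
mean); anything after flow / cooling; `⟨P_x P_y⟩`; numbers.
-/

noncomputable section

namespace Summit.Ventures.LatticeQCDFlow.Exactness

open MeasureTheory Set Function
open Literature.MathematicalPhysics.QuantumFieldTheory
open Literature.MathematicalPhysics.QuantumFieldTheory.WilsonSiteRP (sitePlaqReflect negReflectEquiv)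
open Literature.MathematicalPhysics.QuantumLattice (cloverPseudoscalar continuous_cloverPseudoscalar
  measurable_cloverPseudoscalar exists_abs_cloverPseudoscalar_le fundamentalRep continuous_fundamentalRep
  fundamentalRep_mem_unitaryGroup)
open scoped ENNReal

/-! ## §1 The periodic Wilson measure is translation invariant; `⟨P_x⟩ = 0` at every site -/

section Periodic

variable {d L N : ℕ} [NeZero L] {G : Type*} [Group G] [MeasurableSpace G] (ρ : G →* Matrix (Fin N) (Fin N) ℂ)

/-- **`S(T_v U) = S(U)`**: the Wilson action of the torus is translation invariant. -/
theorem wilsonAction_configTranslate (v : Site d L) (U : GaugeConfig d L G) :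
    wilsonAction ρ (configTranslate v U) = wilsonAction ρ U := by
  rw [← weightedWilsonAction_one ρ (configTranslate v U), ← weightedWilsonAction_one ρ U]
  exact weightedWilsonAction_configTranslate (fun _ => (1 : ℝ)) ρ (c := 1) (fun _ => rfl) v U

variable [TopologicalSpace G] [IsTopologicalGroup G] [CompactSpace G] [BorelSpace G]

/-- **The Wilson measure is translation invariant on every torus**: `μ_{Λ,β} ∘ T_v⁻¹ = μ_{Λ,β}` (product Haar is
invariant under the relabelling of the links, the Boltzmann weight by `wilsonAction_configTranslate`; no continuity
of `ρ` is needed — for a non-measurable weight both sides are the same junk). -/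
theorem wilsonMeasure_map_configTranslate (β : ℝ) (v : Site d L) :
    (wilsonMeasure (d := d) (L := L) ρ β).map (configTranslate v) = wilsonMeasure ρ β := by
  have hw := WilsonGauge.withDensity_map_equiv_of_invariant (Measure.pi fun _ : Edge d L => haarProbability G)
    (configTranslate v) (fun U => ENNReal.ofReal (Real.exp (-β * wilsonAction ρ U)))
    (measurePreserving_configTranslate v (haarProbability G)).map_eq
    (fun U => by simp only [wilsonAction_configTranslate])
  unfold wilsonMeasure
  rw [Measure.map_smul]
  exact congrArg _ hw

/-- `T_v` preserves the Wilson measure. -/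
theorem measurePreserving_configTranslate_wilsonMeasure (β : ℝ) (v : Site d L) :
    MeasurePreserving (configTranslate v) (wilsonMeasure (d := d) (L := L) ρ β) (wilsonMeasure ρ β) :=
  ⟨MeasurableEquiv.measurable _, wilsonMeasure_map_configTranslate ρ β v⟩

/-- **`⟨F ∘ T_v⟩_{Λ,β} = ⟨F⟩_{Λ,β}`** for every observable and every lattice vector (change of variables). -/
theorem wilsonExpectation_comp_configTranslate (β : ℝ) (v : Site d L) {V : Type*} [NormedAddCommGroup V]
    [NormedSpace ℝ V] (F : GaugeConfig d L G → V) :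
    wilsonExpectation ρ β (fun U => F (configTranslate v U)) = wilsonExpectation ρ β F :=
  (measurePreserving_configTranslate_wilsonMeasure ρ β v).integral_comp' F

omit [NeZero L] in
/-- A site in the hyperplane `x₀ = 0` is fixed by the site reflection `θ'`. -/
theorem negReflect_eq_self_of_apply_zero [NeZero d] {x : Site d L} (hx : x 0 = 0) : x.negReflect = x :=
  WilsonSiteRP.negReflect_of_two_mul (by rw [hx, add_zero])

omit [NeZero L] in
/-- Translating `x` by `−x₀ e₀` lands in the hyperplane `x₀ = 0`. -/
theorem single_neg_add_apply_zero [NeZero d] (x : Site d L) : (Pi.single (0 : Fin d) (-x 0) + x : Site d L) 0 = 0 := by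
  rw [Pi.add_apply, Pi.single_eq_same, neg_add_cancel]

/-- **`⟨Σ_{x ∈ S} P_x⟩_{Λ,β} = 0` for EVERY finite set of sites** (slabs, sub-volumes, the whole torus). -/
theorem wilsonExpectation_sum_cloverPseudoscalar_eq_zero [SecondCountableTopology G] (hρ : Continuous ρ)
    (hρu : ∀ g, ρ g ∈ Matrix.unitaryGroup (Fin N) ℂ) (β : ℝ) (S : Finset (Site 4 L)) :
    wilsonExpectation ρ β (fun U : GaugeConfig 4 L G => ∑ x ∈ S, cloverPseudoscalar ρ x U) = 0 := by
  haveI := isProbabilityMeasure_wilsonMeasure (d := 4) (L := L) ρ hρ β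
  have hint : ∀ x ∈ S, Integrable (fun U : GaugeConfig 4 L G => cloverPseudoscalar ρ x U) (wilsonMeasure ρ β) := by
    intro x _
    obtain ⟨C, hC⟩ := exists_abs_cloverPseudoscalar_le ρ hρ x
    exact Integrable.mono' (integrable_const C) (measurable_cloverPseudoscalar ρ hρ x).aestronglyMeasurable
      (ae_of_all _ fun U => by rw [Real.norm_eq_abs]; exact hC U)
  unfold wilsonExpectation
  rw [integral_finsetSum S hint]
  exact Finset.sum_eq_zero fun x _ => Scoring.wilsonExpectation_cloverPseudoscalar_eq_zero ρ hρ hρu β x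

/-- **The `SU(N)` instance** (row 16: `N = 2`; row 21: `N = 3`): `⟨P_x⟩_{Λ,β} = 0` at every site for the fundamental
representation, every real `β`, every `L ≥ 1`. -/
theorem wilsonExpectation_su_cloverPseudoscalar_eq_zero (n : ℕ) (β : ℝ) (x : Site 4 L) :
    wilsonExpectation (fundamentalRep (Fin n)) β
      (fun U : GaugeConfig 4 L (Matrix.specialUnitaryGroup (Fin n) ℂ) => cloverPseudoscalar (fundamentalRep (Fin n)) x U)
      = 0 :=
  Scoring.wilsonExpectation_cloverPseudoscalar_eq_zero (fundamentalRep (Fin n)) (continuous_fundamentalRep (Fin n))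
    fundamentalRep_mem_unitaryGroup β x

end Periodic

/-! ## §2 Open boundary: translations orthogonal to the time direction -/

section OBCTranslate

variable {d L N : ℕ} {G : Type*} [Group G] [MeasurableSpace G] (ρ : G →* Matrix (Fin N) (Fin N) ℂ) {τ : Fin d}
  {v : Site d L}

omit [MeasurableSpace G] in
/-- The open-boundary weights only read the `τ`-coordinate of the base point, which a translation with `v_τ = 0`
does not change. -/
theorem obcWeight_translate (hv : v τ = 0) (q : Plaquette d L) : obcWeight τ (-v + q.1, q.2) = obcWeight τ q := by
  have h0 : (-v + q.1) τ = q.1 τ := by rw [Pi.add_apply, Pi.neg_apply, hv, neg_zero, zero_add]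
  simp only [obcWeight, h0]

variable [NeZero L]

/-- **`S_OBC(T_v U) = S_OBC(U)`** for every translation orthogonal to the time direction (`v_τ = 0`). -/
theorem obcAction_configTranslate (hv : v τ = 0) (U : GaugeConfig d L G) :
    obcAction ρ τ (configTranslate v U) = obcAction ρ τ U := by
  unfold obcAction
  rw [weightedWilsonAction_configTranslate_eq]
  congr 1
  funext q
  exact obcWeight_translate hv q

variable [TopologicalSpace G] [IsTopologicalGroup G] [CompactSpace G] [BorelSpace G]

/-- **The open-boundary Gibbs law is invariant under translations orthogonal to `τ`.** -/
theorem obcGibbs_map_configTranslate (hv : v τ = 0) (β : ℝ) :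
    (gibbsProbability (Measure.pi fun _ : Edge d L => haarProbability G) (fun U => Real.exp (-(β * obcAction ρ τ U)))).map
        (configTranslate v) =
      gibbsProbability (Measure.pi fun _ : Edge d L => haarProbability G) (fun U => Real.exp (-(β * obcAction ρ τ U))) := by
  unfold gibbsProbability
  rw [Measure.map_smul]
  congr 1
  exact WilsonGauge.withDensity_map_equiv_of_invariant _ _ _ (measurePreserving_configTranslate v (haarProbability G)).map_eq
    fun U => by simp only [obcAction_configTranslate ρ hv]

/-- `T_v` (`v_τ = 0`) preserves the open-boundary Gibbs law. -/
theorem measurePreserving_configTranslate_obcGibbs (hv : v τ = 0) (β : ℝ) :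
    MeasurePreserving (configTranslate v)
      (gibbsProbability (Measure.pi fun _ : Edge d L => haarProbability G) (fun U => Real.exp (-(β * obcAction ρ τ U))))
      (gibbsProbability (Measure.pi fun _ : Edge d L => haarProbability G) (fun U => Real.exp (-(β * obcAction ρ τ U)))) :=
  ⟨MeasurableEquiv.measurable _, obcGibbs_map_configTranslate ρ hv β⟩

/-- **`⟨F ∘ T_v⟩_OBC = ⟨F⟩_OBC`** (`v_τ = 0`, every observable). -/
theorem obcGibbs_integral_comp_configTranslate (hv : v τ = 0) (β : ℝ) {V : Type*} [NormedAddCommGroup V]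
    [NormedSpace ℝ V] (F : GaugeConfig d L G → V) :
    ∫ U, F (configTranslate v U) ∂(gibbsProbability (Measure.pi fun _ : Edge d L => haarProbability G)
        (fun U => Real.exp (-(β * obcAction ρ τ U)))) =
      ∫ U, F U ∂(gibbsProbability (Measure.pi fun _ : Edge d L => haarProbability G)
        (fun U => Real.exp (-(β * obcAction ρ τ U)))) :=
  (measurePreserving_configTranslate_obcGibbs ρ hv β).integral_comp' F

end OBCTranslate

/-! ## §3 Open boundary in a direction `τ ≠ 0`: the site reflection of direction `0` is a symmetry -/

section OBCReflect

variable {d L N : ℕ} [NeZero d] {G : Type*} [Group G] (ρ : G →* Matrix (Fin N) (Fin N) ℂ) {τ : Fin d}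

/-- For `τ ≠ 0` the plaquette involution `ϑ'` of `Θ'` does not change the open-boundary weight: it moves base points
only along direction `0` and keeps the plane. -/
theorem obcWeight_sitePlaqReflect (hτ : τ ≠ 0) (q : Plaquette d L) : obcWeight τ (sitePlaqReflect q) = obcWeight τ q := by
  obtain ⟨x, ij⟩ := q
  have h1 : (x.shift 0).negReflect τ = x τ := by
    rw [WilsonSiteRP.negReflect_apply_of_ne _ hτ, shift_apply_of_ne x (Ne.symm hτ)]
  have h2 : x.negReflect τ = x τ := WilsonSiteRP.negReflect_apply_of_ne _ hτ
  have h3 : (if ij.1.1 = 0 then (x.shift 0).negReflect else x.negReflect) τ = x τ := by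
    split_ifs
    · exact h1
    · exact h2
  simp only [obcWeight, sitePlaqReflect, h3]

variable [NeZero L] [TopologicalSpace G] [IsTopologicalGroup G] [CompactSpace G]

/-- **`S_OBC(Θ'U) = S_OBC(U)`** when the open direction `τ` is not the reflected direction `0` (compact `G`,
continuous `ρ`). -/
theorem obcAction_negReflect (hρ : Continuous ρ) (hτ : τ ≠ 0) (U : GaugeConfig d L G) :
    obcAction ρ τ U.negReflect = obcAction ρ τ U := by
  unfold obcAction
  rw [weightedWilsonAction_negReflect _ ρ hρ]
  congr 1
  funext q
  exact obcWeight_sitePlaqReflect hτ q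

variable [MeasurableSpace G] [BorelSpace G]

/-- **The open-boundary Gibbs law (direction `τ ≠ 0`) is `Θ'`-invariant.** -/
theorem obcGibbs_map_negReflect (hρ : Continuous ρ) (hτ : τ ≠ 0) (β : ℝ) :
    (gibbsProbability (Measure.pi fun _ : Edge d L => haarProbability G) (fun U => Real.exp (-(β * obcAction ρ τ U)))).map
        GaugeConfig.negReflect =
      gibbsProbability (Measure.pi fun _ : Edge d L => haarProbability G) (fun U => Real.exp (-(β * obcAction ρ τ U))) := by
  unfold gibbsProbability
  rw [Measure.map_smul]
  congr 1
  exact WilsonGauge.withDensity_map_equiv_of_invariant _ negReflectEquiv _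
    (WilsonSiteRP.measurePreserving_negReflect (d := d) (L := L) (G := G)).map_eq
    fun U => by simp only [show negReflectEquiv U = U.negReflect from rfl, obcAction_negReflect ρ hρ hτ]

/-- `Θ'` preserves the open-boundary Gibbs law of a direction `τ ≠ 0`. -/
theorem measurePreserving_negReflect_obcGibbs (hρ : Continuous ρ) (hτ : τ ≠ 0) (β : ℝ) :
    MeasurePreserving (negReflectEquiv (d := d) (L := L) (G := G))
      (gibbsProbability (Measure.pi fun _ : Edge d L => haarProbability G) (fun U => Real.exp (-(β * obcAction ρ τ U))))
      (gibbsProbability (Measure.pi fun _ : Edge d L => haarProbability G) (fun U => Real.exp (-(β * obcAction ρ τ U)))) :=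
  ⟨MeasurableEquiv.measurable _, obcGibbs_map_negReflect ρ hρ hτ β⟩

/-- **`Θ'`-odd observables have zero mean under the open-boundary Gibbs law of a direction `τ ≠ 0`.** -/
theorem obcGibbs_integral_eq_zero_of_negReflect_odd (hρ : Continuous ρ) (hτ : τ ≠ 0) (β : ℝ) {V : Type*}
    [NormedAddCommGroup V] [NormedSpace ℝ V] {F : GaugeConfig d L G → V} (hF : ∀ U, F U.negReflect = -F U) :
    ∫ U, F U ∂(gibbsProbability (Measure.pi fun _ : Edge d L => haarProbability G)
      (fun U => Real.exp (-(β * obcAction ρ τ U)))) = 0 :=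
  Scoring.integral_eq_zero_of_measurePreserving_odd _ (measurePreserving_negReflect_obcGibbs ρ hρ hτ β) hF

end OBCReflect

/-! ## §4 `⟨P_x⟩_OBC = 0` at every site, `⟨Σ_S P_x⟩_OBC = 0` for every finite set (open direction `τ ≠ 0`) -/

section OBCClover

variable {d L N : ℕ} [NeZero L] {G : Type*} [Group G] [TopologicalSpace G] [IsTopologicalGroup G] [CompactSpace G]
  [MeasurableSpace G] [BorelSpace G] (ρ : G →* Matrix (Fin N) (Fin N) ℂ)

/-- The open-boundary Gibbs law is a probability measure (the weight `e^{−βS_OBC}` is pinched between two positive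
constants on the compact configuration space). -/
theorem isProbabilityMeasure_obcGibbs (hρ : Continuous ρ) (τ : Fin d) (β : ℝ) :
    IsProbabilityMeasure (gibbsProbability (Measure.pi fun _ : Edge d L => haarProbability G)
      (fun U => Real.exp (-(β * obcAction ρ τ U)))) := by
  obtain ⟨s, hs⟩ := exists_bound_smul_obcAction (d := d) (L := L) ρ hρ τ β
  refine isProbabilityMeasure_gibbsProbability (m := Real.exp (-s)) (M := Real.exp s) (Real.exp_pos _)
    (fun U => Real.exp_le_exp.2 ?_) (fun U => Real.exp_le_exp.2 ?_)
  · linarith [(abs_le.1 (hs U)).2]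
  · linarith [(abs_le.1 (hs U)).1]

/-- **`⟨P_x⟩_OBC = 0` AT EVERY SITE** (open direction `τ ≠ 0` in `d = 4`, compact `G`, continuous unitary `ρ`, every
real `β`, `L ≥ 1`, boundary slices included): translate `x` along direction `0` (orthogonal to `τ`, §2) into the
hyperplane `x₀ = 0`, where `P_x` is odd under the symmetry `Θ'` of §3. -/
theorem obcGibbs_cloverPseudoscalar_integral_eq_zero {τ : Fin 4} (hρ : Continuous ρ)
    (hρu : ∀ g, ρ g ∈ Matrix.unitaryGroup (Fin N) ℂ) (hτ : τ ≠ 0) (β : ℝ) (x : Site 4 L) :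
    ∫ U, cloverPseudoscalar ρ x U ∂(gibbsProbability (Measure.pi fun _ : Edge 4 L => haarProbability G)
      (fun U => Real.exp (-(β * obcAction ρ τ U)))) = 0 := by
  have hv : (Pi.single 0 (-x 0) : Site 4 L) τ = 0 := Pi.single_eq_of_ne hτ _
  have h := obcGibbs_integral_comp_configTranslate ρ hv β (fun U : GaugeConfig 4 L G => cloverPseudoscalar ρ x U)
  simp only [cloverPseudoscalar_configTranslate] at h
  rw [← h]
  refine obcGibbs_integral_eq_zero_of_negReflect_odd ρ hρ hτ β fun U => ?_
  rw [Scoring.cloverPseudoscalar_negReflect ρ hρu, negReflect_eq_self_of_apply_zero (single_neg_add_apply_zero x)]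

variable [SecondCountableTopology G]

/-- `P_x` is integrable for the open-boundary Gibbs law (bounded and measurable on a probability space). -/
theorem integrable_cloverPseudoscalar_obcGibbs (hρ : Continuous ρ) (τ : Fin 4) (β : ℝ) (x : Site 4 L) :
    Integrable (fun U : GaugeConfig 4 L G => cloverPseudoscalar ρ x U)
      (gibbsProbability (Measure.pi fun _ : Edge 4 L => haarProbability G)
        (fun U => Real.exp (-(β * obcAction ρ τ U)))) := by
  haveI := isProbabilityMeasure_obcGibbs (d := 4) (L := L) ρ hρ τ β
  obtain ⟨C, hC⟩ := exists_abs_cloverPseudoscalar_le ρ hρ x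
  exact Integrable.mono' (integrable_const C) (measurable_cloverPseudoscalar ρ hρ x).aestronglyMeasurable
    (ae_of_all _ fun U => by rw [Real.norm_eq_abs]; exact hC U)

/-- **`⟨Σ_{x ∈ S} P_x⟩_OBC = 0` FOR EVERY FINITE SET OF SITES** (no symmetry of `S` needed: linearity of the mean over
the integrable densities) — in particular for the charge summed over all sites or over any set of slices. -/
theorem obcGibbs_sum_cloverPseudoscalar_integral_eq_zero {τ : Fin 4} (hρ : Continuous ρ)
    (hρu : ∀ g, ρ g ∈ Matrix.unitaryGroup (Fin N) ℂ) (hτ : τ ≠ 0) (β : ℝ) (S : Finset (Site 4 L)) :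
    ∫ U, ∑ x ∈ S, cloverPseudoscalar ρ x U ∂(gibbsProbability (Measure.pi fun _ : Edge 4 L => haarProbability G)
      (fun U => Real.exp (-(β * obcAction ρ τ U)))) = 0 := by
  rw [integral_finsetSum S fun x _ => integrable_cloverPseudoscalar_obcGibbs ρ hρ τ β x]
  exact Finset.sum_eq_zero fun x _ => obcGibbs_cloverPseudoscalar_integral_eq_zero ρ hρ hρu hτ β x

/-- **The `SU(N)` instance** (row 21's `OBC-HMC` arm, `N = 3`, open direction `τ ≠ 0`): `⟨Σ_{x ∈ S} P_x⟩_OBC = 0` for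
the fundamental representation, every finite `S`, every real `β`, every `L ≥ 1`. -/
theorem obcGibbs_su_sum_cloverPseudoscalar_integral_eq_zero {τ : Fin 4} (hτ : τ ≠ 0) (n : ℕ) (β : ℝ)
    (S : Finset (Site 4 L)) :
    ∫ U, ∑ x ∈ S, cloverPseudoscalar (fundamentalRep (Fin n)) x U ∂(gibbsProbability
      (Measure.pi fun _ : Edge 4 L => haarProbability (Matrix.specialUnitaryGroup (Fin n) ℂ))
      (fun U => Real.exp (-(β * obcAction (fundamentalRep (Fin n)) τ U)))) = 0 :=
  obcGibbs_sum_cloverPseudoscalar_integral_eq_zero (fundamentalRep (Fin n)) (continuous_fundamentalRep (Fin n))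
    fundamentalRep_mem_unitaryGroup hτ β S

end OBCClover

end Summit.Ventures.LatticeQCDFlow.Exactness

/-! ## §5 (appended) `Θ'`-odd observables under the open-boundary Gibbs law of a direction `τ ≠ 0`: symmetric tails, symmetric law, vanishing odd moments

Appended section (GEN-5 of row 21): the law-level companions of §3's `obcGibbs_integral_eq_zero_of_negReflect_odd` for ANY
observable `F` with `F(Θ'U) = −F(U)` — the form the sequel `OpenBoundaryChargeDensity` consumes for slab charges of an open
direction `τ ≠ 0` (row 16's abstract lemmas of `Scoring/CloverChargeLawSymmetric` applied to `measurePreserving_negReflect_obcGibbs`).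
-/

namespace Summit.Ventures.LatticeQCDFlow.Exactness

open MeasureTheory Set Function
open Literature.MathematicalPhysics.QuantumFieldTheory

section OddReflect

variable {d L N : ℕ} [NeZero d] [NeZero L] {G : Type*} [Group G] [TopologicalSpace G] [IsTopologicalGroup G] [CompactSpace G]
  [MeasurableSpace G] [BorelSpace G] (ρ : G →* Matrix (Fin N) (Fin N) ℂ) {τ : Fin d}

/-- **Tail symmetry** `P{c ≤ F} = P{F ≤ −c}` for every `Θ'`-odd real observable under the open-boundary Gibbs law of a direction
`τ ≠ 0`. -/
theorem obcGibbs_tail_symm_of_negReflect_odd (hρ : Continuous ρ) (hτ : τ ≠ 0) (β : ℝ) {F : GaugeConfig d L G → ℝ}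
    (hF : ∀ U, F U.negReflect = -F U) (c : ℝ) :
    gibbsProbability (Measure.pi fun _ : Edge d L => haarProbability G) (fun U => Real.exp (-(β * obcAction ρ τ U)))
        {U | c ≤ F U} =
      gibbsProbability (Measure.pi fun _ : Edge d L => haarProbability G) (fun U => Real.exp (-(β * obcAction ρ τ U)))
        {U | F U ≤ -c} :=
  Scoring.measure_le_eq_measure_le_neg_of_odd _ (measurePreserving_negReflect_obcGibbs ρ hρ hτ β) hF c

/-- **The law of a `Θ'`-odd observable is symmetric about `0`** under the open-boundary Gibbs law of a direction `τ ≠ 0`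
(a.e.-measurable `F`). -/
theorem obcGibbs_map_neg_of_negReflect_odd (hρ : Continuous ρ) (hτ : τ ≠ 0) (β : ℝ) {F : GaugeConfig d L G → ℝ}
    (hFm : AEMeasurable F (gibbsProbability (Measure.pi fun _ : Edge d L => haarProbability G)
      (fun U => Real.exp (-(β * obcAction ρ τ U)))))
    (hF : ∀ U, F U.negReflect = -F U) :
    ((gibbsProbability (Measure.pi fun _ : Edge d L => haarProbability G)
        (fun U => Real.exp (-(β * obcAction ρ τ U)))).map F).map Neg.neg =
      (gibbsProbability (Measure.pi fun _ : Edge d L => haarProbability G)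
        (fun U => Real.exp (-(β * obcAction ρ τ U)))).map F :=
  Scoring.map_neg_map_of_odd _ (measurePreserving_negReflect_obcGibbs ρ hρ hτ β) hFm hF

/-- **Odd moments of a `Θ'`-odd observable vanish** under the open-boundary Gibbs law of a direction `τ ≠ 0`: `∫ F^{2k+1} = 0`. -/
theorem obcGibbs_integral_pow_odd_of_negReflect_odd (hρ : Continuous ρ) (hτ : τ ≠ 0) (β : ℝ) {F : GaugeConfig d L G → ℝ}
    (hF : ∀ U, F U.negReflect = -F U) (k : ℕ) :
    ∫ U, F U ^ (2 * k + 1) ∂(gibbsProbability (Measure.pi fun _ : Edge d L => haarProbability G)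
      (fun U => Real.exp (-(β * obcAction ρ τ U)))) = 0 :=
  Scoring.integral_pow_odd_eq_zero_of_odd _ (measurePreserving_negReflect_obcGibbs ρ hρ hτ β) hF k

/-- **For every `g`, `∫ g(F) = ∫ g(−F)`** under the open-boundary Gibbs law of a direction `τ ≠ 0` when `F` is `Θ'`-odd. -/
theorem obcGibbs_integral_comp_eq_comp_neg_of_negReflect_odd (hρ : Continuous ρ) (hτ : τ ≠ 0) (β : ℝ)
    {F : GaugeConfig d L G → ℝ} (hF : ∀ U, F U.negReflect = -F U) {V : Type*} [NormedAddCommGroup V] [NormedSpace ℝ V]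
    (g : ℝ → V) :
    ∫ U, g (F U) ∂(gibbsProbability (Measure.pi fun _ : Edge d L => haarProbability G)
        (fun U => Real.exp (-(β * obcAction ρ τ U)))) =
      ∫ U, g (-F U) ∂(gibbsProbability (Measure.pi fun _ : Edge d L => haarProbability G)
        (fun U => Real.exp (-(β * obcAction ρ τ U)))) :=
  Scoring.integral_comp_eq_integral_comp_neg_of_odd _ (measurePreserving_negReflect_obcGibbs ρ hρ hτ β) hF g

end OddReflect

end Summit.Ventures.LatticeQCDFlow.Exactness
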